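import Mathlib
import Literature.NumberTheory.DiophantineGeometry.AbcWave0

/-!
# Family L3 of the three-prime zoo: reduction to Ljunggren's 1943 equation (unconditional)

Support for `SolvedZooABC` (stmt-ABC-24025, `route-ABC-ThreeSlotCyclotomicDescent`), family (iii)
of the typed statement (a.k.a. L3): `a = 1`, `b = 2^x · q²`, `c = r^z` with `q, r` prime, `r` odd,
`z` odd, `3 ≤ z` — i.e. the exponential Diophantine equation `r^z = 2^x · q² + 1`.

Main results (elementary, sorry-free, no named fact used):

* `l3_reduce`: `r ^ z = 2 ^ x * q ^ 2 + 1` with `q` prime, `1 < r`, `z` odd, `3 ≤ z` forces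
  `∑_{i<z} r^i = q²` and `r = 2^x + 1`. The first conclusion is LITERALLY the hypothesis shape
  `(Finset.range n).sum (fun i => x ^ i) = y ^ 2` of Ljunggren's 1943 theorem
  "(xⁿ − 1)/(x − 1) = y², x > 1, n > 2 ⟹ (x, n, y) ∈ {(3, 5, 11), (7, 4, 20)}" (Ljunggren, Norsk Mat.
  Tidsskr. 25 (1943) 17–20; secondary: Shorey–Tijdeman, *Exponential Diophantine equations* (1986),
  p. 178), which is typed SEPARATELY as a Literature named fact and is neither used nor restated here.
* `l3_reduce_div`: the same in the division form `(r ^ z - 1) / (r - 1) = q ^ 2`.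
* `l3_reduce_of_isABCTriple`: the family-(iii) packaging over `IsABCTriple 1 (2^x q²) (r^z)`.

Proof: `r^z − 1 = (r − 1) · S` with `S = ∑_{i<z} r^i`; `S` is odd because `z` is odd
(`odd_geom_sum`), so `S ∣ q²` and `S ∈ {1, q, q²}`; `S ≥ 1 + r + r² > r`, and `S = q` would give
`r − 1 = 2^x · q ≥ q = S > r`; hence `S = q²` and then `r − 1 = 2^x`.

HONESTY: this file is UNCONDITIONAL but proves NO conjunct of stmt-ABC-24025 by itself — the L3
conjunct follows from it only modulo Ljunggren 1943 (consumer file). INPUTS→UNCONDITIONAL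
(D-0154 (2)) bookkeeping; not abc, not the cell B₃; abc moved by 0.
-/

namespace Summit.ABC.ABC.Theorems.SolvedZooL3Reduction

open Finset
open Literature.NumberTheory.DiophantineGeometry (IsABCTriple)

/-- A geometric sum with an odd number of terms is odd: `∑_{i<n} r^i` is odd for odd `n`
(group the terms after the first in consecutive pairs `r^(2j+1) + r^(2j+2) = r^(2j) · (r · (r+1))`,
each even). [folklore] -/
theorem odd_geom_sum (r : ℕ) {n : ℕ} (hn : Odd n) : Odd (∑ i ∈ range n, r ^ i) := by
  obtain ⟨m, rfl⟩ := hn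
  induction m with
  | zero => simp
  | succ m ih =>
    have e : 2 * (m + 1) + 1 = (2 * m + 1) + 1 + 1 := by ring
    rw [e, sum_range_succ, sum_range_succ, add_assoc]
    refine ih.add_even ?_
    have : r ^ (2 * m + 1) + r ^ (2 * m + 1 + 1) = r ^ (2 * m) * (r * (r + 1)) := by ring
    rw [this]
    exact (Nat.even_mul_succ_self r).mul_left _

/-- `(r - 1) · ∑_{i<z} r^i + 1 = r^z` in `ℕ`, for `1 ≤ r` (Mathlib's `geom_sum_mul_add`,
repackaged). [folklore] -/
theorem pred_mul_geom_sum_add_one {r : ℕ} (hr : 1 ≤ r) (z : ℕ) :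
    (r - 1) * (∑ i ∈ range z, r ^ i) + 1 = r ^ z := by
  obtain ⟨s, rfl⟩ : ∃ s, r = s + 1 := ⟨r - 1, by omega⟩
  rw [Nat.add_sub_cancel, mul_comm]
  exact geom_sum_mul_add s z

/-- The first three terms bound a geometric sum with at least three terms:
`1 + r + r² ≤ ∑_{i<z} r^i` for `3 ≤ z`. [folklore] -/
theorem three_terms_le_geom_sum (r : ℕ) {z : ℕ} (hz : 3 ≤ z) :
    1 + r + r ^ 2 ≤ ∑ i ∈ range z, r ^ i := by
  have hsub : range 3 ⊆ range z := range_subset_range.mpr hz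
  have h := sum_le_sum_of_subset (f := fun i => r ^ i) hsub
  have h3 : ∑ i ∈ range 3, r ^ i = 1 + r + r ^ 2 := by
    simp [sum_range_succ, pow_succ]
  rw [h3] at h
  exact h

/-- **Reduction of family L3 to Ljunggren's 1943 equation.** If `r ^ z = 2 ^ x * q ^ 2 + 1` with
`q` prime, `1 < r`, `z` odd and `3 ≤ z`, then the geometric sum `∑_{i<z} r^i = (r^z − 1)/(r − 1)`
equals `q²` and `r = 2^x + 1`. Elementary (parity of the geometric sum + `q` prime); no named
fact is used. [folklore] -/
theorem l3_reduce {x q r z : ℕ} (hq : q.Prime) (hr : 1 < r) (hz : Odd z) (h3 : 3 ≤ z)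
    (h : r ^ z = 2 ^ x * q ^ 2 + 1) :
    (∑ i ∈ range z, r ^ i) = q ^ 2 ∧ r = 2 ^ x + 1 := by
  set S := ∑ i ∈ range z, r ^ i with hS
  -- `(r - 1) * S = 2^x * q^2`
  have hkey : (r - 1) * S = 2 ^ x * q ^ 2 := by
    have h1 := pred_mul_geom_sum_add_one (le_of_lt hr) z
    rw [h] at h1
    exact Nat.add_right_cancel h1
  -- `S` is odd, hence coprime to `2^x`, hence `S ∣ q^2`
  have hSodd : Odd S := odd_geom_sum r hz
  have hSdvd : S ∣ 2 ^ x * q ^ 2 := ⟨r - 1, by rw [← hkey, mul_comm]⟩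
  have hScop : Nat.Coprime S (2 ^ x) :=
    Nat.Coprime.pow_right x (Nat.coprime_two_right.mpr hSodd)
  have hSq : S ∣ q ^ 2 := hScop.dvd_of_dvd_mul_left hSdvd
  obtain ⟨i, hi, hSi⟩ := (Nat.dvd_prime_pow hq).mp hSq
  -- `S ≥ 1 + r + r² > r ≥ 2`
  have hS3 : 1 + r + r ^ 2 ≤ S := three_terms_le_geom_sum r h3
  have hr2 : r ≤ r ^ 2 := Nat.le_self_pow (by norm_num) r
  interval_cases i
  · -- `S = 1`: impossible
    rw [pow_zero] at hSi
    omega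
  · -- `S = q`: then `r - 1 = 2^x * q ≥ q = S > r`
    rw [pow_one] at hSi
    have hcancel : r - 1 = 2 ^ x * q := by
      have h2 : (r - 1) * q = (2 ^ x * q) * q := by
        rw [← hSi, hkey, hSi]; ring
      exact Nat.eq_of_mul_eq_mul_right hq.pos h2
    have hxq : q ≤ 2 ^ x * q := Nat.le_mul_of_pos_left q (Nat.two_pow_pos x)
    omega
  · -- `S = q²`: then `r - 1 = 2^x`
    refine ⟨hSi, ?_⟩
    have h2 : (r - 1) * q ^ 2 = 2 ^ x * q ^ 2 := by rw [← hSi, hkey, hSi]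
    have hcancel : r - 1 = 2 ^ x :=
      Nat.eq_of_mul_eq_mul_right (pow_pos hq.pos 2) h2
    omega

/-- **Division form** of `l3_reduce`: under the same hypotheses,
`(r ^ z - 1) / (r - 1) = q ^ 2` and `r = 2 ^ x + 1` (via `Nat.geomSum_eq`). [folklore] -/
theorem l3_reduce_div {x q r z : ℕ} (hq : q.Prime) (hr : 1 < r) (hz : Odd z) (h3 : 3 ≤ z)
    (h : r ^ z = 2 ^ x * q ^ 2 + 1) :
    (r ^ z - 1) / (r - 1) = q ^ 2 ∧ r = 2 ^ x + 1 := by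
  obtain ⟨hS, hr'⟩ := l3_reduce hq hr hz h3 h
  exact ⟨(Nat.geomSum_eq hr z) ▸ hS, hr'⟩

/-- **Family (iii) of `SolvedZooABC`, reduced.** For an abc triple `(1, 2^x · q², r^z)` with
`q, r` prime, `z` odd, `3 ≤ z` (the typed family L3 of stmt-ABC-24025; the typed side condition
`Odd r` is not needed for this step): `∑_{i<z} r^i = q²` and `r = 2^x + 1` — the input shape of
Ljunggren's 1943 theorem with `(x, n, y) := (r, z, q)`. [folklore] -/
theorem l3_reduce_of_isABCTriple {a b c x q r z : ℕ} (ht : IsABCTriple a b c) (hq : q.Prime)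
    (hr : r.Prime) (hz : Odd z) (h3 : 3 ≤ z) (ha : a = 1) (hb : b = 2 ^ x * q ^ 2)
    (hc : c = r ^ z) :
    (∑ i ∈ range z, r ^ i) = q ^ 2 ∧ r = 2 ^ x + 1 := by
  subst ha hb hc
  have h : r ^ z = 2 ^ x * q ^ 2 + 1 := by have := ht.2.2.1; omega
  exact l3_reduce hq hr.one_lt hz h3 h

/-- The swapped orientation `(2^x · q², 1, r^z)` of family (iii) reduces identically. [folklore] -/
theorem l3_reduce_of_isABCTriple_swap {a b c x q r z : ℕ} (ht : IsABCTriple a b c) (hq : q.Prime)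
    (hr : r.Prime) (hz : Odd z) (h3 : 3 ≤ z) (hb : b = 1) (ha : a = 2 ^ x * q ^ 2)
    (hc : c = r ^ z) :
    (∑ i ∈ range z, r ^ i) = q ^ 2 ∧ r = 2 ^ x + 1 := by
  subst ha hb hc
  have h : r ^ z = 2 ^ x * q ^ 2 + 1 := by have := ht.2.2.1; omega
  exact l3_reduce hq hr.one_lt hz h3 h

end Summit.ABC.ABC.Theorems.SolvedZooL3Reduction
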